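import Literature.NumberTheory.Automorphic.WhittakerCoeffTranslateNonvanishingOutside
import Literature.NumberTheory.Automorphic.FinComponentLevelTransport
import Literature.NumberTheory.Automorphic.CuspidalLevelSupportedIn
import Literature.NumberTheory.Automorphic.ArchRankinSelbergPairBridgeTranslate
import Literature.NumberTheory.Automorphic.CuspidalRepArchIsotypic
import HarnessLib

/-!
# A level supported on `S` on which the transferred Whittaker functional does not vanish at `D_f`

Topic `NumberTheory/Automorphic`; namespace `Literature.NumberTheory.Automorphic`. Theorems only. A
step of the entireness of `L^S(s, π × σ)` for `π ≇ σ̃` (Mœglin–Waldspurger (1989), Appendice,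
Corollaire (i)(b)) at ARBITRARY level: for a cuspidal automorphic representation `π` of
`GL_n(𝔸_K)` with a Satake family off the finite set `S`, archimedean component `τ` (irreducible,
unitary, strongly continuous, occurring in `π`) and a torus element `τ_A = (1, D_f)` whose local shape
at every `v ∉ S` is that of the Whittaker shifts (`exists_whittakerShiftTorus_outside`), there is an
intertwiner `T₁ : τ → π` of a principal congruence level `K_f(𝔫₁)`, `𝔫₁ ≠ 0` with all its prime
factors in `S`, such that the transferred global Whittaker functional of the translate `D_f · T₁` is
non-zero: `Φ_ℓ(D_f · T₁) ≠ 0` (`exists_level_supportedIn_transferMap_translate_ne_zero`).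

Proof (Cogdell (2004), §1.2 with Jacquet–Shalika's non-vanishing of the unramified Whittaker
function): a non-zero vector of `π` of a level `K(𝔫_π)` supported on `S`
(`CuspidalLevelSupportedIn`), smoothed by an approximate identity of level `K(𝔫_π)`
(`exists_adInvariant_isTestFunctionGL_norm_smoothedVector_sub_le`), has a Whittaker function with
`W(diag(τ_A) g) ≠ 0` at a point `g` integral outside `S`
(`exists_whittakerCoeff_smoothedForm_translate_ne_zero_forall_not_mem`); decomposing the level piece
of the conjugate level `c K_f(𝔫_π) c⁻¹`, `c = (diag(τ_A) g)_f = D_f g_f`, into copies of `τ`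
(`exists_levelPiece_decomposition`) gives `W(diag(τ_A) g) = Σ_i Φ_ℓ(S_i)(τ(g_∞) e_i)`
(`whittakerCoeff_smoothedForm_eq_sum_transferMap_of_sndHom_eq`), so `Φ_ℓ(S_i) ≠ 0` for some `i`; the
translate `T₁ = g_f · (c⁻¹ · S_i)` has level `K_f(𝔫_π ∏_{v ∈ S} 𝔭_v^{r_v})`
(`exists_finComponentRep_mem_archIntertwinersLevel`, as `g` is integral outside `S`) and
`D_f · T₁ = S_i`.

## References

* C. Mœglin, J.-L. Waldspurger, *Le spectre résiduel de GL(n)*, Ann. Sci. ÉNS 22 (1989), Appendice,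
  Corollaire (i)(b), p. 667 [MoeglinWaldspurger1989].
* J. W. Cogdell, *Analytic theory of L-functions for GL_n* (2004), §1.2, §3.1 Thm. 3.3, §4.1
  [CogdellAnalyticTheory2004].
* H. Jacquet, J. A. Shalika, *On Euler products and the classification of automorphic
  representations I*, Amer. J. Math. 103 (1981), Prop. 2.3, (5.1) [JacquetShalikaAJM1981].
-/

noncomputable section

open MeasureTheory Measure NumberField NumberField.mixedEmbedding IsDedekindDomain Set Filter WithZero ValuativeRel
open Literature.NumberTheory.GaloisRepresentations (ideleGroup)
open scoped MatrixGroups ENNReal NNReal ComplexConjugate Classical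

namespace Literature.NumberTheory.Automorphic

-- the automorphic quotient carries the tree's Borel σ-algebra, not Mathlib's quotient σ-algebra
attribute [-instance] Quotient.instMeasurableSpace QuotientGroup.measurableSpace

section Conj

variable {n : ℕ} {K : Type} [Field K] [NumberField K]

/-- **A conjugate `c U c⁻¹` of a compact open subgroup of `GL_n(𝔸_K^∞)` is compact open**, and
`c⁻¹ u c ∈ U` for `u ∈ c U c⁻¹`. [folklore] -/
theorem conj_isOpen_isCompact {U : Subgroup (GL (Fin n) (FiniteAdeleRing (𝓞 K) K))}
    (hUo : IsOpen (U : Set (GL (Fin n) (FiniteAdeleRing (𝓞 K) K))))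
    (hUc : IsCompact (U : Set (GL (Fin n) (FiniteAdeleRing (𝓞 K) K))))
    (c : GL (Fin n) (FiniteAdeleRing (𝓞 K) K)) :
    IsOpen ((U.map (MulAut.conj c).toMonoidHom : Subgroup (GL (Fin n) (FiniteAdeleRing (𝓞 K) K))) :
        Set (GL (Fin n) (FiniteAdeleRing (𝓞 K) K))) ∧
      IsCompact ((U.map (MulAut.conj c).toMonoidHom : Subgroup (GL (Fin n) (FiniteAdeleRing (𝓞 K) K))) :
        Set (GL (Fin n) (FiniteAdeleRing (𝓞 K) K))) ∧
      ∀ u ∈ U.map (MulAut.conj c).toMonoidHom, c⁻¹ * u * c ∈ U := by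
  refine ⟨?_, ?_, ?_⟩
  · rw [Subgroup.map_equiv_eq_comap_symm']
    change IsOpen ((fun x => (MulAut.conj c).symm.toMonoidHom x) ⁻¹' (U : Set _))
    refine hUo.preimage ?_
    change Continuous fun x => (MulAut.conj c).symm x
    simp only [MulAut.conj_symm_apply]
    exact (continuous_const.mul continuous_id).mul continuous_const
  · rw [Subgroup.coe_map]
    refine hUc.image ?_
    change Continuous fun x => MulAut.conj c x
    simp only [MulAut.conj_apply]
    exact (continuous_const.mul continuous_id).mul continuous_const
  · rintro _ ⟨u₀, hu₀, rfl⟩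
    change c⁻¹ * (MulAut.conj c u₀) * c ∈ _
    rw [MulAut.conj_apply, show c⁻¹ * (c * u₀ * c⁻¹) * c = u₀ by group]
    exact hu₀

/-- `GL_n(𝒪_v) ≤ K_v(1)` (the valued congruence subgroup of radius `1`). [folklore] -/
theorem mem_valuedCongruenceSubgroup_one_of_mem_glInt {v : HeightOneSpectrum (𝓞 K)}
    {g : GL (Fin n) (v.adicCompletion K)} (h : g ∈ glInt n (v.adicCompletion K)) :
    g ∈ valuedCongruenceSubgroup (Fin n) (1 : ℤᵐ⁰) := by
  obtain ⟨h1, h2⟩ := (mem_glInt_iff g).1 h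
  refine mem_valuedCongruenceSubgroup_iff.2 ⟨fun i j => (mem_integer_adicCompletion_iff K v).1 (h1 i j),
    fun i j => (mem_integer_adicCompletion_iff K v).1 (h2 i j), fun i j => ?_⟩
  rw [Matrix.sub_apply]
  refine (Valuation.map_sub _ _ _).trans (max_le ((mem_integer_adicCompletion_iff K v).1 (h1 i j)) ?_)
  rw [Matrix.one_apply]
  split_ifs <;> simp

end Conj

section Main

variable {n : ℕ} {K : Type} [Field K] [NumberField K]
variable {μ : Measure (AdelicGroupData.gl n K).automorphicQuotient} [(AdelicGroupData.gl n K).IsAutomorphicMeasure μ]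

attribute [local instance] adelicBorel borelSpace_adelic locallyCompactSpace_adelic secondCountableTopology_gl_adelic
  glAdeleBorel borelSpace_glAdele

variable [MeasurableSpace (AdeleRing (𝓞 K) K)] [BorelSpace (AdeleRing (𝓞 K) K)]

set_option maxHeartbeats 1600000 in
/-- **A level supported on `S` on which `Φ_ℓ(D_f · T₁) ≠ 0`.** Let `π` be cuspidal with a Satake
family off the finite set `S`, `τ` its archimedean component (irreducible, unitary, strongly
continuous, occurring in `π`), `ℓ` the global Whittaker functional on the Gårding space, and
`τ_A ∈ (𝔸_Kˣ)ⁿ` a torus element with the local shape of the Whittaker shifts at every `v ∉ S`. Then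
there are `𝔫₁ ≠ 0` with all prime factors in `S` and `T₁ ∈ Hom_{G_∞}(τ, π^{K_f(𝔫₁)})` with
`Φ_ℓ(diag(τ_A)_f · T₁) ≠ 0`. [cite: CogdellAnalyticTheory2004, §1.2 and §3.1 Thm. 3.3]
[cite: MoeglinWaldspurger1989, Appendice, Corollaire (i)(b), p. 667] -/
theorem exists_level_supportedIn_transferMap_translate_ne_zero (hcpt : isCompact_glFiniteIntegralLevel n K)
    (hn : 1 ≤ n) (P : CuspidalAutomorphicRepGL n K μ) {S : Set (HeightOneSpectrum (𝓞 K))} {α : SatakeFamily K}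
    (hα : IsSatakeFamilyOf P S α) (Sf : Finset (HeightOneSpectrum (𝓞 K))) (hSf : ∀ v ∈ S, v ∈ Sf)
    {E : Type*} [NormedAddCommGroup E] [InnerProductSpace ℂ E] [CompleteSpace E]
    {τ : ContRepresentation ℂ (AutomorphyDatum.gl n K hcpt).arch.carrier E}
    (hτu : τ.IsUnitary) (hτi : τ.IsTopIrreducible) (hτc : τ.IsStronglyContinuous)
    (hex : ∃ T ∈ archIntertwiners hcpt τ P.1, T ≠ 0)
    (ν₀ : Measure ↥(adelicUnipotent n K)) [IsHaarMeasure ν₀]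
    (τA : Fin n → ideleGroup K)
    (hτψ : ∀ v ∉ S, ∃ (d : Fin n → (v.adicCompletion K)ˣ) (a : (v.adicCompletion K)ˣ),
      localComponent v (glDiagonal n (AdeleRing (𝓞 K) K) τA) = diagonalGL (Fin n) (v.adicCompletion K) d ∧
      (∀ i j : Fin n, (i : ℕ) + 1 = j →
        (d i : v.adicCompletion K) * ((d j)⁻¹ : (v.adicCompletion K)ˣ) = a) ∧
      (∀ c ∈ 𝒪[v.adicCompletion K], (adeleAddChar K).adicComponent v (a * c) = 1) ∧
      ∀ ϖ : v.adicCompletion K, Valued.v ϖ = WithZero.exp (-1 : ℤ) →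
        ∃ c ∈ 𝒪[v.adicCompletion K], (adeleAddChar K).adicComponent v (a * (ϖ⁻¹ * c)) ≠ 1) :
    ∃ (𝔫₁ : Ideal (𝓞 K)) (_ : 𝔫₁ ≠ 0) (_ : ∀ v : HeightOneSpectrum (𝓞 K), v.asIdeal ∣ 𝔫₁ → v ∈ Sf)
      (T₁ : multiplicityModule hcpt τ P.1),
      (T₁ : E →L[ℂ] (AdelicGroupData.gl n K).L2 μ) ∈
        archIntertwinersLevel hcpt τ P.1 (finitePrincipalCongruenceLevel n K 𝔫₁) ∧
      transferMap (whittakerFunctional ν₀ (continuous_adeleAddChar K)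
          (ContRepresentation.Equiv.refl P.1.toContRep)) hτc
        (finComponentRep hcpt τ P.1 (GLn.sndHom n K (glDiagonal n (AdeleRing (𝓞 K) K) τA)) T₁) ≠ 0 := by
  classical
  -- (1) a non-zero vector of a level supported on `S`, and an approximate identity of that level
  obtain ⟨𝔫P, h𝔫P, hS𝔫P, f₀, hf₀0, hf₀K⟩ := hα.exists_fixedVectors_level_supportedIn
  have hUl : principalCongruenceLevel n K 𝔫P ∈ (AutomorphyDatum.gl n K hcpt).finiteLevels := by
    rw [AutomorphyDatum.gl_finiteLevels]
    exact principalCongruenceLevel_mem_finiteLevelsGL_holds n K h𝔫P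
  have hε : 0 < ‖f₀‖ / 2 := half_pos (norm_pos_iff.2 hf₀0)
  obtain ⟨η, hη, hηK, -, hle⟩ :=
    exists_adInvariant_isTestFunctionGL_norm_smoothedVector_sub_le hcpt P.1 hUl f₀ hf₀K hε
  have hS0 : smoothedVector P.1 η f₀ ≠ 0 := by
    intro h0
    rw [h0, zero_sub, norm_neg] at hle
    linarith [norm_pos_iff.2 hf₀0]
  have hne0 : smoothedForm η ((f₀ : P.1.toSubmodule) : (AdelicGroupData.gl n K).L2 μ) ≠ 0 :=
    smoothedForm_ne_zero_of_smoothedVector_ne_zero hη.continuous hη.hasCompactSupport hS0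
  -- (2) a point `g`, integral outside `S`, with `W(diag(τ_A) g) ≠ 0`
  have hS𝔫 : ∀ v ∉ S, ¬ v.asIdeal ∣ 𝔫P := fun v hv h => hv (hS𝔫P v h)
  obtain ⟨g, hgint, hWg⟩ := exists_whittakerCoeff_smoothedForm_translate_ne_zero_forall_not_mem hn P hα ν₀ h𝔫P
    hS𝔫 hη hηK f₀ hne0 τA hτψ
  set D : GL (Fin n) (AdeleRing (𝓞 K) K) := glDiagonal n (AdeleRing (𝓞 K) K) τA with hD
  set c : GL (Fin n) (FiniteAdeleRing (𝓞 K) K) := GLn.sndHom n K (D * g) with hc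
  -- (3) the decomposition of the level piece of the conjugate level `c K_f(𝔫_π) c⁻¹`
  set U₀ : Subgroup (GL (Fin n) (FiniteAdeleRing (𝓞 K) K)) :=
    (finitePrincipalCongruenceLevel n K 𝔫P).map (MulAut.conj c).toMonoidHom with hU₀
  obtain ⟨hU₀o, hU₀c, hcU⟩ := conj_isOpen_isCompact (isOpen_finitePrincipalCongruenceLevel n K h𝔫P)
    (isCompact_finitePrincipalCongruenceLevel n K h𝔫P) c
  obtain ⟨k, Sx, hSx, hSon, hspan, -⟩ := exists_levelPiece_decomposition hcpt P hτu hτi hex hU₀o hU₀c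
  -- left invariance of `η((D g)⁻¹ ·)` under `(1, U₀)`
  have hηK' : ∀ u ∈ finitePrincipalCongruenceLevel n K 𝔫P, ∀ x : GL (Fin n) (AdeleRing (𝓞 K) K),
      η (GLn.ofFinite n K u * x) = η x := fun u hu x => hηK _ hu x
  have hleftg : ∀ u ∈ U₀, ∀ x : GL (Fin n) (AdeleRing (𝓞 K) K),
      η ((D * g)⁻¹ * (GLn.ofFinite n K u * x)) = η ((D * g)⁻¹ * x) := by
    intro u hu x
    have hu' := hcU u hu
    have key : (D * g)⁻¹ * GLn.ofFinite n K u = GLn.ofFinite n K (c⁻¹ * u * c) * (D * g)⁻¹ := by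
      set m : GL (Fin n) (AdeleRing (𝓞 K) K) := GLn.ofInfinite n K (GLn.toMixed n K (D * g)) with hm
      have hdec : D * g = m * GLn.ofFinite n K c := by
        rw [hc, hm, GLn.ofInfinite_toMixed_mul_ofFinite_sndHom]
      have hcomm : m⁻¹ * GLn.ofFinite n K u = GLn.ofFinite n K u * m⁻¹ := by
        rw [hm, ← map_inv]; exact (GLn.commute_ofInfinite_ofFinite _ _).eq
      rw [hdec, _root_.mul_inv_rev, map_mul, map_mul, map_inv]
      calc (GLn.ofFinite n K c)⁻¹ * m⁻¹ * GLn.ofFinite n K u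
          = (GLn.ofFinite n K c)⁻¹ * (m⁻¹ * GLn.ofFinite n K u) := by group
        _ = (GLn.ofFinite n K c)⁻¹ * (GLn.ofFinite n K u * m⁻¹) := by rw [hcomm]
        _ = (GLn.ofFinite n K c)⁻¹ * GLn.ofFinite n K u * GLn.ofFinite n K c *
              ((GLn.ofFinite n K c)⁻¹ * m⁻¹) := by group
    rw [← mul_assoc, key, mul_assoc, hηK' _ hu']
  -- the Gårding vector `R((1, c)) S_η f₀` of the conjugate level and its components
  have hvT : P.1.toContRep (GLn.ofFinite n K c) (smoothedVector P.1 η f₀) ∈ gardingSubspace P.1 U₀ := by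
    have hTleft : ∀ u ∈ U₀, ∀ x : GL (Fin n) (AdeleRing (𝓞 K) K),
        η ((GLn.ofFinite n K c)⁻¹ * (GLn.ofFinite n K u * x)) = η ((GLn.ofFinite n K c)⁻¹ * x) := by
      intro u hu x
      rw [← mul_assoc, ← map_inv, ← map_mul, show c⁻¹ * u = c⁻¹ * u * c * c⁻¹ by group, map_mul, mul_assoc,
        hηK' _ (hcU u hu), map_inv]
    rw [toContRep_smoothedVector_eq _ hη.continuous hη.hasCompactSupport _ f₀]
    exact smoothedVector_mem_gardingSubspace (hη.comp_mul_left _) hTleft f₀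
  set e : Fin k → archGardingSpace hcpt τ := fun i =>
    ⟨ContinuousLinearMap.adjoint (Sx i) ((P.1.toContRep (GLn.ofFinite n K c) (smoothedVector P.1 η f₀) : P.1.toSubmodule) :
        (AdelicGroupData.gl n K).L2 μ),
      (eq_sum_apply_of_mem_gardingSubspace P hτu hτi hτc hex hSx hSon hspan hU₀o hU₀c hvT).1 i⟩
    with he_def
  have he : ∀ i, (e i : E) = ContinuousLinearMap.adjoint (Sx i)
      ((P.1.toContRep (GLn.ofFinite n K c) (smoothedVector P.1 η f₀) : P.1.toSubmodule) :
        (AdelicGroupData.gl n K).L2 μ) := fun i => rfl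
  have hW := whittakerCoeff_smoothedForm_eq_sum_transferMap_of_sndHom_eq hcpt P hτu hτi hτc hex hU₀o hU₀c hSx hSon hspan ν₀
    hη f₀ (g := D * g) (c := c) rfl hleftg e he
  rw [hW] at hWg
  obtain ⟨i₀, -, hi₀⟩ := Finset.exists_ne_zero_of_sum_ne_zero hWg
  -- (4) the intertwiner `S_{i₀}` of level `U₀` with `Φ_ℓ(S_{i₀}) ≠ 0`, and its translates
  set Tst : multiplicityModule hcpt τ P.1 := ⟨Sx i₀, mem_multiplicityModule_of_mem_archIntertwinersLevel hU₀o hU₀c (hSx i₀)⟩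
    with hTst
  have hTst0 : transferMap (whittakerFunctional ν₀ (continuous_adeleAddChar K)
      (ContRepresentation.Equiv.refl P.1.toContRep)) hτc Tst ≠ 0 := fun h0 => hi₀ (by rw [h0, LinearMap.zero_apply])
  -- `T♭ = c⁻¹ · S_{i₀}` has level `K_f(𝔫_π)`
  set Tfl : multiplicityModule hcpt τ P.1 := finComponentRep hcpt τ P.1 c⁻¹ Tst with hTfl
  have hTflmem : (Tfl : E →L[ℂ] (AdelicGroupData.gl n K).L2 μ) ∈
      archIntertwinersLevel hcpt τ P.1 (finitePrincipalCongruenceLevel n K 𝔫P) := by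
    refine finComponentRep_mem_archIntertwinersLevel_of_conj Tst (hSx i₀) c⁻¹ fun u hu => ?_
    rw [inv_inv]
    exact ⟨u, hu, rfl⟩
  -- `T₁ = g_f · T♭`, of level supported on `S`
  have hgf : ∀ w ∉ Sf, BigHeckeGLn.localComponent n K w (GLn.sndHom n K g) ∈ valuedCongruenceSubgroup (Fin n) (1 : ℤᵐ⁰) := by
    intro w hw
    rw [BigHeckeGLn.localComponent_sndHom]
    exact mem_valuedCongruenceSubgroup_one_of_mem_glInt (hgint w fun h => hw (hSf w h))
  obtain ⟨r, hT₁⟩ := exists_finComponentRep_mem_archIntertwinersLevel Sf h𝔫P Tfl hTflmem (GLn.sndHom n K g) hgf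
  refine ⟨spreadLevelIdeal 𝔫P r Sf.toList, spreadLevelIdeal_ne_zero h𝔫P r _, fun v hv => ?_,
    finComponentRep hcpt τ P.1 (GLn.sndHom n K g) Tfl, hT₁, ?_⟩
  · rcases mem_or_dvd_of_dvd_spreadLevelIdeal_toList r hv with h | h
    · exact hSf v (hS𝔫P v h)
    · exact h
  · -- `D_f · (g_f · (c⁻¹ · S_{i₀})) = S_{i₀}`
    have hprod : GLn.sndHom n K D * GLn.sndHom n K g * c⁻¹ = 1 := by
      rw [hc, map_mul, mul_inv_cancel]
    have heq : finComponentRep hcpt τ P.1 (GLn.sndHom n K D) (finComponentRep hcpt τ P.1 (GLn.sndHom n K g) Tfl) = Tst := by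
      rw [hTfl, ← Module.End.mul_apply, ← map_mul, ← Module.End.mul_apply, ← map_mul, hprod, map_one,
        Module.End.one_apply]
    rw [heq]
    exact hTst0

end Main

end Literature.NumberTheory.Automorphic
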